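import Literature.Geometry.Lorentzian.ChartCalculus
import Mathlib.Analysis.InnerProductSpace.Calculus
import Mathlib.Analysis.Calculus.Deriv.Inv
import Mathlib.Analysis.SpecialFunctions.Sqrt
import HarnessLib

/-!
# The radial presentation `v ↦ v/‖v‖` of the unit sphere of a model open set

Topic `Geometry/Riemannian` (chart calculus, `OpensChart` setting). In the round picture of the
interior surgery of Weinstein's disk (Weinstein 1968, proof of the main theorem, step (3)) the
boundary sphere `S = {‖v‖ = 1}` of the model open set `U : Opens V` is presented to the cone-map
layer (`ConeRadialIsometry.lean`) by the positively `0`-homogeneous map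
`ι(v) = φ⁻¹(v/‖v‖) ∈ U` (`φ⁻¹` the inverse chart of `U`, i.e. the inclusion). This file records
the calculus of the normalisation `N(v) = v/‖v‖` and of `ι`:

* `hasFDerivAt_inv_norm₀`, `hasFDerivAt_normalize`, `fderiv_normalize_apply` —
  `d(‖·‖⁻¹)_x = -‖x‖⁻³ ⟪x, ·⟫` (chain rule through `‖·‖²`), hence
  `dN_x(z) = ‖x‖⁻¹ z - ‖x‖⁻³ ⟪x, z⟫ x`;
* `inner_fderiv_normalize` — `⟪x, dN_x z⟫ = 0` (`‖N‖ ≡ 1` near `x`);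
* `fderiv_normalize_of_inner_eq_zero` — `dN_x z = ‖x‖⁻¹ z` for `z ⊥ x` (so `dN_x` is injective on
  `x^⊥`, `fderiv_normalize_injOn`);
* `normalize_smul` — `N(t v) = N(v)` for `t > 0`;
* `coe_spherePresentation`, `contMDiffOn_spherePresentation`, `mfderiv_spherePresentation_apply`,
  `spherePresentation_smul`, `spherePresentation_injOn` — the same facts for `ι = φ⁻¹ ∘ N : V → U`
  when the unit sphere lies in `U`.

## References

* A. Weinstein, Ann. of Math. (2) 87 (1968), 29–41, proof of the main theorem, step (3).
  [cite: Weinstein1968]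
* J. M. Lee, *Introduction to Riemannian Manifolds*, 2nd ed. (2018), Example 8.25 (the sphere as
  a level set, radial unit normal). [cite: LeeRiemannianManifolds2018, Example 8.25]

Tags: [ChartCalculus] [Sphere] [Weinstein1968]
-/

noncomputable section

open Bundle Set Function Filter TopologicalSpace
open scoped Manifold ContDiff Topology RealInnerProductSpace

namespace Literature.Geometry.Riemannian

open Literature.Geometry.Lorentzian
open Literature.Geometry.Lorentzian.OpensChart

variable {V : Type*} [NormedAddCommGroup V] [InnerProductSpace ℝ V]

/-! ### Calculus of the normalisation `N(v) = ‖v‖⁻¹ v` -/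

/-- **`d(‖·‖⁻¹)_x = -‖x‖⁻³ ⟪x, ·⟫`** for `x ≠ 0`. [folklore] -/
theorem hasFDerivAt_inv_norm₀ {x : V} (hx : x ≠ 0) :
    HasFDerivAt (fun y : V ↦ ‖y‖⁻¹) ((-(‖x‖ ^ 3)⁻¹) • (innerSL ℝ x : V →L[ℝ] ℝ)) x := by
  have hxn : ‖x‖ ≠ 0 := norm_ne_zero_iff.2 hx
  have hx2 : ‖x‖ ^ 2 ≠ 0 := pow_ne_zero 2 hxn
  have hsq : Real.sqrt (‖x‖ ^ 2) = ‖x‖ := Real.sqrt_sq (norm_nonneg x)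
  -- `‖y‖⁻¹ = (√(‖y‖²))⁻¹`
  have h1 : HasDerivAt (fun s : ℝ ↦ (Real.sqrt s)⁻¹)
      (-(1 / (2 * Real.sqrt (‖x‖ ^ 2))) / Real.sqrt (‖x‖ ^ 2) ^ 2) (‖x‖ ^ 2) :=
    (Real.hasDerivAt_sqrt hx2).inv (by rw [hsq]; exact hxn)
  have h2 : HasFDerivAt (fun y : V ↦ ‖y‖ ^ 2) (2 • (innerSL ℝ x : V →L[ℝ] ℝ)) x :=
    (hasStrictFDerivAt_norm_sq x).hasFDerivAt
  have h3 := h1.comp_hasFDerivAt x h2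
  have hfun : (fun y : V ↦ ‖y‖⁻¹) = (fun s : ℝ ↦ (Real.sqrt s)⁻¹) ∘ fun y : V ↦ ‖y‖ ^ 2 := by
    funext y
    simp only [comp_apply, Real.sqrt_sq (norm_nonneg y)]
  rw [hfun]
  refine h3.congr_fderiv ?_
  rw [hsq, ← Nat.cast_smul_eq_nsmul ℝ, smul_smul]
  congr 1
  push_cast
  field_simp

/-- **`dN_x = ‖x‖⁻¹ id - ‖x‖⁻³ ⟪x, ·⟫ x`** for the normalisation `N(y) = ‖y‖⁻¹ y` at `x ≠ 0`
(product rule). [folklore] -/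
theorem hasFDerivAt_normalize {x : V} (hx : x ≠ 0) :
    HasFDerivAt (fun y : V ↦ ‖y‖⁻¹ • y)
      (‖x‖⁻¹ • ContinuousLinearMap.id ℝ V +
        ((-(‖x‖ ^ 3)⁻¹) • (innerSL ℝ x : V →L[ℝ] ℝ)).smulRight x) x :=
  (hasFDerivAt_inv_norm₀ hx).smul (hasFDerivAt_id x)

/-- Pointwise form: `dN_x z = ‖x‖⁻¹ z - ‖x‖⁻³ ⟪x, z⟫ x`. [folklore] -/
theorem fderiv_normalize_apply {x : V} (hx : x ≠ 0) (z : V) :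
    fderiv ℝ (fun y : V ↦ ‖y‖⁻¹ • y) x z = ‖x‖⁻¹ • z + (-(‖x‖ ^ 3)⁻¹ * ⟪x, z⟫) • x := by
  rw [(hasFDerivAt_normalize hx).fderiv]
  simp [ContinuousLinearMap.smulRight_apply, innerSL_apply_apply]

/-- The normalisation is differentiable away from `0`. [folklore] -/
theorem differentiableAt_normalize {x : V} (hx : x ≠ 0) :
    DifferentiableAt ℝ (fun y : V ↦ ‖y‖⁻¹ • y) x :=
  (hasFDerivAt_normalize hx).differentiableAt

/-- The normalisation is `C^n` away from `0`. [folklore] -/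
theorem contDiffAt_normalize {x : V} (hx : x ≠ 0) {n : WithTop ℕ∞} :
    ContDiffAt ℝ n (fun y : V ↦ ‖y‖⁻¹ • y) x :=
  ((contDiffAt_norm ℝ hx).inv (norm_ne_zero_iff.2 hx)).smul contDiffAt_id

/-- **`dN_x z = ‖x‖⁻¹ z` for `z ⊥ x`.** [folklore] -/
theorem fderiv_normalize_of_inner_eq_zero {x z : V} (hx : x ≠ 0) (hz : ⟪x, z⟫ = 0) :
    fderiv ℝ (fun y : V ↦ ‖y‖⁻¹ • y) x z = ‖x‖⁻¹ • z := by
  rw [fderiv_normalize_apply hx, hz, mul_zero, zero_smul, add_zero]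

/-- **`⟪x, dN_x z⟫ = 0`** — the differential of the normalisation is tangent to the sphere.
[folklore] -/
theorem inner_fderiv_normalize {x : V} (hx : x ≠ 0) (z : V) :
    ⟪x, fderiv ℝ (fun y : V ↦ ‖y‖⁻¹ • y) x z⟫ = 0 := by
  have hn : ‖x‖ ≠ 0 := norm_ne_zero_iff.2 hx
  rw [fderiv_normalize_apply hx, inner_add_right, inner_smul_right, inner_smul_right,
    real_inner_self_eq_norm_sq]
  field_simp
  ring

/-- **`dN_x` is injective on `x^⊥`** (`dN_x z = ‖x‖⁻¹ z` there). [folklore] -/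
theorem fderiv_normalize_injOn {x : V} (hx : x ≠ 0) {z : V} (hz : ⟪x, z⟫ = 0)
    (h0 : fderiv ℝ (fun y : V ↦ ‖y‖⁻¹ • y) x z = 0) : z = 0 := by
  rw [fderiv_normalize_of_inner_eq_zero hx hz] at h0
  rcases smul_eq_zero.1 h0 with h | h
  · exact absurd h (inv_ne_zero (norm_ne_zero_iff.2 hx))
  · exact h

/-- **Positive `0`-homogeneity: `N(t v) = N(v)` for `t > 0`.** [folklore] -/
theorem normalize_smul {t : ℝ} (ht : 0 < t) (v : V) : ‖t • v‖⁻¹ • (t • v) = ‖v‖⁻¹ • v := by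
  by_cases hv : v = 0
  · subst hv; simp
  · rw [norm_smul, Real.norm_eq_abs, abs_of_pos ht, mul_inv, smul_smul]
    congr 1
    field_simp

/-! ### The presentation `ι = φ⁻¹ ∘ N : V → U` -/

variable {U : Opens V}

/-- **`ι v = N v` as a point of `V`** when the unit sphere lies in `U` (and `v ≠ 0`).
[folklore] -/
theorem coe_spherePresentation (u₀ : U) (hSU : ∀ w : V, ‖w‖ = 1 → w ∈ U) {v : V} (hv : v ≠ 0) :
    (((extChartAt 𝓘(ℝ, V) u₀).symm (‖v‖⁻¹ • v) : U) : V) = ‖v‖⁻¹ • v :=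
  OpensChart.extChartAt_symm_val u₀ (hSU _ (by rw [norm_smul, norm_inv, norm_norm, inv_mul_cancel₀ (norm_ne_zero_iff.2 hv)]))

/-- **`ι` is `C^∞` away from `0`.** [folklore] -/
theorem contMDiffOn_spherePresentation (u₀ : U) (hSU : ∀ w : V, ‖w‖ = 1 → w ∈ U) :
    ContMDiffOn 𝓘(ℝ, V) 𝓘(ℝ, V) ∞
      (fun v : V ↦ (extChartAt 𝓘(ℝ, V) u₀).symm (‖v‖⁻¹ • v)) {v : V | v ≠ 0} := by
  intro v hv
  have hv' : v ≠ 0 := hv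
  have h1 : ContMDiffAt 𝓘(ℝ, V) 𝓘(ℝ, V) ∞ (fun y : V ↦ ‖y‖⁻¹ • y) v :=
    (contDiffAt_normalize hv').contMDiffAt
  have hmem : ‖v‖⁻¹ • v ∈ (extChartAt 𝓘(ℝ, V) u₀).target := by
    rw [OpensChart.extChartAt_target]
    exact hSU _ (by rw [norm_smul, norm_inv, norm_norm, inv_mul_cancel₀ (norm_ne_zero_iff.2 hv')])
  have h2 : ContMDiffAt 𝓘(ℝ, V) 𝓘(ℝ, V) ∞ (extChartAt 𝓘(ℝ, V) u₀).symm (‖v‖⁻¹ • v) :=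
    (contMDiffOn_extChartAt_symm u₀).contMDiffAt
      ((isOpen_extChartAt_target u₀).mem_nhds hmem)
  exact (ContMDiffAt.comp (f := fun y : V ↦ ‖y‖⁻¹ • y) v h2 h1).contMDiffWithinAt

/-- **`dι_v z = dN_v z`** read in `V` (the inverse chart of `U` has identity differential).
[folklore] -/
theorem mfderiv_spherePresentation_apply (u₀ : U) (hSU : ∀ w : V, ‖w‖ = 1 → w ∈ U) {v : V}
    (hv : v ≠ 0) (z : V) :
    mfderiv 𝓘(ℝ, V) 𝓘(ℝ, V) (fun v : V ↦ (extChartAt 𝓘(ℝ, V) u₀).symm (‖v‖⁻¹ • v)) v z =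
      fderiv ℝ (fun y : V ↦ ‖y‖⁻¹ • y) v z := by
  have hmemU : ‖v‖⁻¹ • v ∈ U :=
    hSU _ (by rw [norm_smul, norm_inv, norm_norm, inv_mul_cancel₀ (norm_ne_zero_iff.2 hv)])
  have hmem : ‖v‖⁻¹ • v ∈ (extChartAt 𝓘(ℝ, V) u₀).target := by
    rw [OpensChart.extChartAt_target]; exact hmemU
  have hd1 : MDifferentiableAt 𝓘(ℝ, V) 𝓘(ℝ, V) (fun y : V ↦ ‖y‖⁻¹ • y) v :=
    mdifferentiableAt_iff_differentiableAt.2 (differentiableAt_normalize hv)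
  have hd2 : MDifferentiableAt 𝓘(ℝ, V) 𝓘(ℝ, V) (extChartAt 𝓘(ℝ, V) u₀).symm (‖v‖⁻¹ • v) :=
    (mdifferentiableWithinAt_extChartAt_symm hmem).mdifferentiableAt
      (by rw [ModelWithCorners.range_eq_univ]; exact univ_mem)
  have H := hd2.hasMFDerivAt.comp v (f := fun y : V ↦ ‖y‖⁻¹ • y) hd1.hasMFDerivAt
  have e : mfderiv 𝓘(ℝ, V) 𝓘(ℝ, V) (fun v : V ↦ (extChartAt 𝓘(ℝ, V) u₀).symm (‖v‖⁻¹ • v)) v =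
      (mfderiv 𝓘(ℝ, V) 𝓘(ℝ, V) (extChartAt 𝓘(ℝ, V) u₀).symm (‖v‖⁻¹ • v)).comp
        (mfderiv 𝓘(ℝ, V) 𝓘(ℝ, V) (fun y : V ↦ ‖y‖⁻¹ • y) v) := H.mfderiv
  rw [e, ContinuousLinearMap.comp_apply, OpensChart.mfderiv_extChartAt_symm_apply u₀ hmemU,
    mfderiv_eq_fderiv]
  rfl

/-- **Positive `0`-homogeneity of `ι`.** [folklore] -/
theorem spherePresentation_smul (u₀ : U) {t : ℝ} (ht : 0 < t) (v : V) :
    (extChartAt 𝓘(ℝ, V) u₀).symm (‖t • v‖⁻¹ • (t • v)) =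
      (extChartAt 𝓘(ℝ, V) u₀).symm (‖v‖⁻¹ • v) := by
  rw [normalize_smul ht v]

/-- **`ι` is injective on the unit sphere** (it is the identity there). [folklore] -/
theorem spherePresentation_injOn (u₀ : U) (hSU : ∀ w : V, ‖w‖ = 1 → w ∈ U) {v w : V}
    (hv : ‖v‖ = 1) (hw : ‖w‖ = 1)
    (h : (extChartAt 𝓘(ℝ, V) u₀).symm (‖v‖⁻¹ • v) = (extChartAt 𝓘(ℝ, V) u₀).symm (‖w‖⁻¹ • w)) :
    v = w := by
  have hv0 : v ≠ 0 := by rw [← norm_ne_zero_iff, hv]; exact one_ne_zero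
  have hw0 : w ≠ 0 := by rw [← norm_ne_zero_iff, hw]; exact one_ne_zero
  have h' : (((extChartAt 𝓘(ℝ, V) u₀).symm (‖v‖⁻¹ • v) : U) : V) =
      (((extChartAt 𝓘(ℝ, V) u₀).symm (‖w‖⁻¹ • w) : U) : V) := by rw [h]
  rw [coe_spherePresentation u₀ hSU hv0, coe_spherePresentation u₀ hSU hw0, hv, hw, inv_one,
    one_smul, one_smul] at h'
  exact h'

end Literature.Geometry.Riemannian

end
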